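import Literature.Barriers.FinalStateConjecture.KleinGordonSuperradiantInstability
import Literature.Geometry.Lorentzian.KerrWaveEnergy
import Literature.Geometry.Lorentzian.KerrHyperboloidalLeaves
import Mathlib.Analysis.SpecialFunctions.JapaneseBracket
import Mathlib.MeasureTheory.Integral.DominatedConvergence
import Mathlib.Analysis.Calculus.MeanValue
import HarnessLib

/-!
# Barrier catalogue `FinalStateConjecture`: Shlapentokh-Rothman's superradiant instability —
# reduction of the named fact `KleinGordonSuperradiantInstability` (Thm. 1.1) to the printed
# mode theorem (Thm. 1.2) in Kerr–Schild chart (profile) form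
(`Literature/Barriers/FinalStateConjecture/`, D-0021, D-0014; family `gr`; namespace
`Literature.Barriers.FinalStateConjecture`)

`KleinGordonSuperradiantInstability.lean` vendors Shlapentokh-Rothman's Theorem 1.1 (Comm. Math.
Phys. 329 (2014) 859–891 = arXiv:1302.3448) as a named fact in existence form: on every
sub-extremal Kerr exterior with `a ≠ 0`, for masses `μ` arbitrarily close to `|am|/(2Mr₊)`, a
smooth real solution of `□_g ψ = μ² ψ` with finite coordinate Klein–Gordon energy on every leaf
`{t_KS = τ}`, `τ ≥ 0`, and first-order energy `≥ c e^{ε τ}`. Discharging it is theory-sized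
(triage XL): the printed proof constructs *mode solutions* (Thm. 1.2) from the angular
Sturm–Liouville problem with holomorphic eigenvalue curves (second appendix), the Frobenius / irregular-
singular-point theory of the radial ODE at `r₊` and at infinity (first and third appendices), a variational
construction of real modes (Props. 4.1–4.2) and an implicit-function perturbation into the upper
half-plane (§4.3, Lemma 4.5); and Theorem 1.1 is Theorem 1.2 read at a small `ε > 0`. Following
D-0014 this file

* vendors the printed **mode theorem** as ONE named fact, in **profile (stationary) form**,
  `ShlapentokhRothman2014_unstableModeProfile` (Thm. 1.2 with the boundary behaviour of §2 and of
  the appendix on the local theory of the radial ODE, and the mass clause of Thm. 1.1/abstract), in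
  the ingoing Kerr–Schild chart of the prelude: a mass `μ > 0` with `|μ − |am|/(2Mr₊)| < δ`, a
  frequency `ω ∈ ℂ` with `Im ω > 0`, `Re ω ≠ 0`, `|am| > 2Mr₊|ω|` (superradiant), and a spatial
  profile `Φ : E3 → ℂ`, smooth and not identically zero on the exterior slice `{r > r₊}`, with
  `|Φ|, ‖DΦ‖ ≤ C e^{−κ‖y‖}` there (bound state, smooth up to `𝓗⁺`), solving the reduced equation
  on the leaf, `P_ω Φ = μ² Φ` on `Kerr.slice a r₊`, where `P_ω` (`reducedWaveOp`, with the mode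
  fluxes `modeFlux`) is the divergence form `Σ_μ ∂_μ(g^{μν} ∂_ν ·)` of `□_g` in the unimodular,
  stationary Kerr–Schild chart with `∂_{t_KS} ↦ −iω`;
* **proves** `□_g Re(e^{−iωt_KS}Φ) = Re(e^{−iωt_KS} P_ω Φ)` on the exterior (`dalembertian_modeRe`,
  from `Kerr.dalembertian_eq_divergence`, stationarity `∂_{t_KS} g^{μν} = 0` and the product rule),
  whence a profile solving `P_ω Φ = μ²Φ` on the slice gives the real mode
  `ψ = Re(e^{−iω t_KS} Φ(y))` (`modeRe`) solving `□_{g_{M,a}} ψ = μ² ψ` on `Kerr.exterior M a`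
  (`dalembertian_modeRe_of_reducedWaveOp`) — the whole time-dependence of the problem is thereby
  proved, not assumed;
* **proves** the step "Theorem 1.2 ⟹ Theorem 1.1" of the paper for the vendored (energy) form of
  Theorem 1.1, for one mode with fixed parameters (`exists_sliceEnergy_growth_of_mode`) and, with
  it, the reduction
  `KleinGordonSuperradiantInstability.of_unstableModeProfile :
    ShlapentokhRothman2014_unstableModeProfile → KleinGordonSuperradiantInstability`:
  for the mode `ψ = Re(e^{−iωt_KS}Φ)`, `ω = ω_R + iε`, the coordinate energy density on
  the leaf `{t_KS = τ}` is `e^{2ετ} q(−ω_R τ, y)` with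
  `q(θ, y) = Re(−iω e^{iθ}Φ(y))² + Σ_j Re(e^{iθ} ∂_jΦ(y))²` (`modeDensity`,
  `coordEnergyDensity_modeRe`); `Q(θ) = ∫_{r > r₊} q(θ, y) dy` is finite (the bound-state decay makes
  `e^{−2κ‖y‖}` an integrable majorant on `ℝ³`, `integrable_exp_neg_mul_norm`), continuous in `θ`
  (dominated convergence), `2π`-periodic and *strictly positive*: `Q(θ) = 0` forces
  `∇ Re(e^{iθ}Φ) = 0` on the open connected slice (`Kerr.SliceFacts.isConnected_slice`), so
  `Re(e^{iθ}Φ)` is a constant, which vanishes by decay along the end `{‖y‖ > R}` of the slice, and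
  then `Re(−iω e^{iθ}Φ) = −ω_R · Im(e^{iθ}Φ) = 0` with `ω_R ≠ 0` gives `Φ ≡ 0` on the slice — excluded.
  Hence `min_{[0,2π]} Q = c₀ > 0` and `sliceEnergy ψ τ = e^{2ετ} Q(−ω_Rτ) ≥ c₀ e^{2ετ}` for all `τ`,
  while `kgSliceEnergy ψ τ μ ≤ e^{2ετ}(Q + μ² C² ∫e^{−2κ‖y‖}) < ∞`.

When `ShlapentokhRothman2014_unstableModeProfile` is discharged (its own decomposition — angular
eigenpairs, horizon and infinity local theory of the radial ODE, variational real modes, IFT, and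
the purely spatial coordinate identity "separated profiles `e^{−iω(r+c)}e^{imφ}S(θ)f(r)` solve
`P_ω Φ = μ²Φ` on the leaf" — is recorded in the unit notes),
`theorem KleinGordonSuperradiantInstability_holds := .of_unstableModeProfile ‹_›` lands here
(append protocol).

## Design

* The mode is handled through its global representative `modeRe ω Φ : E4 → ℝ`,
  `x ↦ Re(exp(−iω x⁰) Φ(x¹, x², x³))`; the wave `ψ` of the barrier statement is its restriction to
  the open chart `Kerr.exterior M a`, so `ContMDiff` and the `fderiv`s inside `coordEnergyDensity`
  (taken of the extension by zero) are those of `modeRe` (`OpensChart.contMDiffAt_iff`,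
  `fderiv_extend_eq`).
* Only `Im ω > 0`, `Re ω ≠ 0`, smoothness/decay/non-vanishing of `Φ` on the slice and the equation
  are used by the reduction; the superradiance inequality is carried because it is printed in
  Thm. 1.2 and is the content of the word "superradiant".
* No Mathlib duplication: Mathlib has no Lorentzian wave equations; used are `integrable_one_add_norm`
  (Japanese bracket), `continuous_of_dominated`, `Measure.eqOn_open_of_ae_eq`,
  `IsOpen.is_const_of_fderiv_eq_zero`, `Function.Periodic.exists_mem_Ico₀`, `HasFDerivAt.mul`.
* One named fact, not two: an earlier revision of this file also vendored Thm. 1.2 a second time,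
  in spacetime (chart) form, as a named fact `ShlapentokhRothman2014_unstableMode` sitting between
  the profile form and the barrier. It differed from the profile form only by the proved identity
  `dalembertian_modeRe` and carried the same proof debt, so it has been merged into the proved
  pointwise theorems `exists_sliceEnergy_growth_of_mode` and `dalembertian_modeRe_of_reducedWaveOp`
  (review of the decomposition under D-0026/D-0027: no restatement layers as separate facts).

## References

* Y. Shlapentokh-Rothman, *Exponentially growing finite energy solutions for the Klein–Gordon
  equation on sub-extremal Kerr spacetimes*, Comm. Math. Phys. 329 (2014) 859–891,
  arXiv:1302.3448: abstract, Thm. 1.1, §1.3 Thm. 1.2 (mode theorem) and Thm. 1.3, §2 (mode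
  solutions, horizon regularity (2.3)–(2.4), finite-energy requirement), §4.2–§4.3, and the third
  appendix, *Local theory for the radial ODE* (§9 of the held copy, Lemma 9.1:
  `ρ₁ ~ e^{−√(μ²−ω²) r} r^{…}`) (key `ShlapentokhRothman2014KleinGordon`; section/lemma numbers as in
  the held store copy `paper:arxiv-1302.3448`, whose appendices are numbered §7–§9).
* S. Klainerman, *The black hole stability problem*, C. R. Mécanique 353 (2025) 555–581, §2.5 (3),
  p. 562 (superradiance among the difficulties of the Kerr stability problem) (key `Klainerman2025`).
* M. Dafermos, I. Rodnianski, *Lectures on black holes and linear waves*, arXiv:0811.0354, §5.1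
  (ingoing Kerr–Schild chart, `t_KS = t* − r + const`) (key `arXiv08110354`).
-/

noncomputable section

open Set Filter MeasureTheory TopologicalSpace Topology
open scoped Manifold ContDiff ENNReal Real

namespace Literature.Barriers.FinalStateConjecture

open Literature.Geometry.Lorentzian

/-! ### The real Kerr–Schild-chart mode `Re(e^{−iω t_KS} Φ(y))` and its first derivatives -/

/-- The **real part of a Kerr–Schild-chart mode** with complex frequency `ω` and spatial profile
`Φ : E3 → ℂ`: `modeRe ω Φ x = Re(exp(−iω x⁰) · Φ(x¹, x², x³))`, `x⁰ = t_KS` the time of the ingoing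
Kerr–Schild chart. For a printed mode `e^{−iωt}e^{imφ}S_{ml}(θ)R(r)` (Boyer–Lindquist), smooth across
`𝓗⁺` in Kerr-star coordinates `ψ = e^{−iωt*}e^{imφ*}S_{ml}(θ)f(r)` (SR §2), one has
`t* = t_KS + r + const` (Dafermos–Rodnianski, arXiv:0811.0354, §5.1), so `ψ = e^{−iωt_KS} Φ(y)` with
`Φ` smooth on `{r > r₊}`; real parts of complex solutions of the real linear equation
`(□_g − μ²)ψ = 0` are real solutions. Shlapentokh-Rothman, CMP 329 (2014), §1.3 (1.5) and §2.
[cite: ShlapentokhRothman2014KleinGordon, §1.3 (1.5) and §2] -/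
def modeRe (w : ℂ) (Φ : E3 → ℂ) (x : E4) : ℝ :=
  (Complex.exp (-(Complex.I * w) * ((x 0 : ℝ) : ℂ)) * Φ (E4.spatial x)).re

/-- The phase exponent `x ↦ −iω x⁰` of a Kerr–Schild-chart mode as a real-linear map `E4 → ℂ`.
SR, CMP 329 (2014), §1.3 (1.5). [cite: ShlapentokhRothman2014KleinGordon, §1.3 (1.5)] -/
def phaseCLM (w : ℂ) : E4 →L[ℝ] ℂ :=
  (-(Complex.I * w)) • (Complex.ofRealCLM.comp (EuclideanSpace.proj (0 : Fin 4)))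

/-- `phaseCLM ω x = −iω x⁰`. [folklore] -/
@[simp]
theorem phaseCLM_apply (w : ℂ) (x : E4) : phaseCLM w x = -(Complex.I * w) * ((x 0 : ℝ) : ℂ) := by
  simp [phaseCLM]

/-- The **profile energy density** of a mode: for a phase `θ` and a point `y` of the slice,
`q(θ, y) = Re(−iω e^{iθ} Φ(y))² + Σ_{j<3} Re(e^{iθ} ∂_jΦ(y))²` — the coordinate energy density
`Σ_ν (∂_ν Re(e^{−iωt_KS}Φ))²` on the leaf `{t_KS = τ}` with the growth factor `e^{2 Im ω τ}` divided out
and `θ = −Re ω · τ` (`coordEnergyDensity_modeRe`). SR, CMP 329 (2014), Thm. 1.1 (the printed growth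
`e^{ε_μ t}|∂^αψ(0)| ≲ |∂^αψ(t)|`) and §1.2.2 (the energy). [cite: ShlapentokhRothman2014KleinGordon, Thm. 1.1 and §1.2.2] -/
def modeDensity (w : ℂ) (Φ : E3 → ℂ) (θ : ℝ) (y : E3) : ℝ :=
  (-(Complex.I * w) * Complex.exp ((θ : ℂ) * Complex.I) * Φ y).re ^ 2 +
    ∑ j : Fin 3, (Complex.exp ((θ : ℂ) * Complex.I) * fderiv ℝ Φ y (EuclideanSpace.single j 1)).re ^ 2

/-- The profile energy density is nonnegative (a sum of squares). [folklore] -/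
theorem modeDensity_nonneg (w : ℂ) (Φ : E3 → ℂ) (θ : ℝ) (y : E3) : 0 ≤ modeDensity w Φ θ y :=
  add_nonneg (sq_nonneg _) (Finset.sum_nonneg fun _ _ ↦ sq_nonneg _)

/-- The profile energy density is `2π`-periodic in the phase (`e^{i(θ+2π)} = e^{iθ}`). [folklore] -/
theorem modeDensity_periodic (w : ℂ) (Φ : E3 → ℂ) (y : E3) :
    Function.Periodic (fun θ ↦ modeDensity w Φ θ y) (2 * π) := by
  intro θ
  have h : Complex.exp (((θ + 2 * π : ℝ) : ℂ) * Complex.I) = Complex.exp ((θ : ℂ) * Complex.I) := by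
    rw [show ((θ + 2 * π : ℝ) : ℂ) * Complex.I = (θ : ℂ) * Complex.I + 2 * π * Complex.I by
      push_cast; ring, Complex.exp_add, Complex.exp_two_pi_mul_I, mul_one]
  simp only [modeDensity, h]

/-- **Derivative of the real mode.** If `Φ` has derivative `Φ'` at `y = (x¹, x², x³)`, then
`modeRe ω Φ` has derivative `Re ∘ (e^{−iωx⁰} Φ' ∘ spatial + Φ(y) e^{−iωx⁰} (−iω dx⁰))` at `x`
(product and chain rules). [folklore] -/
theorem hasFDerivAt_modeRe (w : ℂ) {Φ : E3 → ℂ} {Φ' : E3 →L[ℝ] ℂ} {x : E4}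
    (hΦ : HasFDerivAt Φ Φ' (E4.spatial x)) :
    HasFDerivAt (modeRe w Φ)
      (Complex.reCLM.comp
        (Complex.exp (-(Complex.I * w) * ((x 0 : ℝ) : ℂ)) • (Φ'.comp E4.spatial) +
          Φ (E4.spatial x) • (Complex.exp (-(Complex.I * w) * ((x 0 : ℝ) : ℂ)) • phaseCLM w))) x := by
  have hE : HasFDerivAt (fun x : E4 ↦ Complex.exp (-(Complex.I * w) * ((x 0 : ℝ) : ℂ)))
      (Complex.exp (-(Complex.I * w) * ((x 0 : ℝ) : ℂ)) • phaseCLM w) x := by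
    have h := (Complex.hasDerivAt_exp (phaseCLM w x)).comp_hasFDerivAt x (phaseCLM w).hasFDerivAt
    simp only [phaseCLM_apply] at h
    refine h.congr_of_eventuallyEq (Eventually.of_forall fun z ↦ ?_)
    simp
  have hG : HasFDerivAt (fun x : E4 ↦ Φ (E4.spatial x)) (Φ'.comp E4.spatial) x :=
    hΦ.comp x E4.spatial.hasFDerivAt
  have hprod := hE.mul hG
  have hre := Complex.reCLM.hasFDerivAt.comp x hprod
  refine hre.congr_of_eventuallyEq (Eventually.of_forall fun z ↦ ?_)
  simp [modeRe]

/-- `∂₀` of the real mode: `∂_{t_KS} Re(e^{−iωt_KS}Φ(y)) = Re(−iω e^{−iωt_KS} Φ(y))`. [folklore] -/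
theorem fderiv_modeRe_basisVector_zero (w : ℂ) {Φ : E3 → ℂ} {x : E4}
    (hΦ : DifferentiableAt ℝ Φ (E4.spatial x)) :
    fderiv ℝ (modeRe w Φ) x (E4.basisVector 0) =
      (-(Complex.I * w) * Complex.exp (-(Complex.I * w) * ((x 0 : ℝ) : ℂ)) * Φ (E4.spatial x)).re := by
  rw [(hasFDerivAt_modeRe w hΦ.hasFDerivAt).fderiv]
  simp
  ring_nf

/-- `∂_{j+1}` of the real mode: `∂_{y_j} Re(e^{−iωt_KS}Φ(y)) = Re(e^{−iωt_KS} ∂_jΦ(y))`. [folklore] -/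
theorem fderiv_modeRe_basisVector_succ (w : ℂ) {Φ : E3 → ℂ} {x : E4}
    (hΦ : DifferentiableAt ℝ Φ (E4.spatial x)) (j : Fin 3) :
    fderiv ℝ (modeRe w Φ) x (E4.basisVector j.succ) =
      (Complex.exp (-(Complex.I * w) * ((x 0 : ℝ) : ℂ)) *
        fderiv ℝ Φ (E4.spatial x) (EuclideanSpace.single j 1)).re := by
  rw [(hasFDerivAt_modeRe w hΦ.hasFDerivAt).fderiv]
  simp [Fin.succ_ne_zero]

/-- Splitting of the phase factor on the leaf `{t_KS = τ}`: `e^{−iωτ} = e^{Im ω · τ} · e^{−i Re ω · τ}`.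
[folklore] -/
theorem exp_phase_eq (w : ℂ) (τ : ℝ) :
    Complex.exp (-(Complex.I * w) * ((τ : ℝ) : ℂ)) =
      ((Real.exp (w.im * τ) : ℝ) : ℂ) * Complex.exp (((-(w.re * τ) : ℝ) : ℂ) * Complex.I) := by
  rw [Complex.ofReal_exp, ← Complex.exp_add]
  congr 1
  apply Complex.ext <;> simp

/-- The real mode is `C^n` at `x` when the profile is `C^n` at `(x¹, x², x³)` (composition of the
entire `exp`, real-linear maps, the profile and `Re`). [folklore] -/
theorem contDiffAt_modeRe (w : ℂ) {Φ : E3 → ℂ} {x : E4} {n : WithTop ℕ∞}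
    (hΦ : ContDiffAt ℝ n Φ (E4.spatial x)) : ContDiffAt ℝ n (modeRe w Φ) x := by
  have hE : ContDiff ℝ n (fun x : E4 ↦ Complex.exp (-(Complex.I * w) * ((x 0 : ℝ) : ℂ))) := by
    have heq : (fun x : E4 ↦ Complex.exp (-(Complex.I * w) * ((x 0 : ℝ) : ℂ))) =
        fun x ↦ Complex.exp (phaseCLM w x) := by
      funext z; simp
    rw [heq]
    exact Complex.contDiff_exp.comp (phaseCLM w).contDiff
  have hG : ContDiffAt ℝ n (fun x : E4 ↦ Φ (E4.spatial x)) x := hΦ.comp x E4.spatial.contDiff.contDiffAt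
  have h := Complex.reCLM.contDiff.contDiffAt.comp x (hE.contDiffAt.mul hG)
  refine h.congr_of_eventuallyEq (Eventually.of_forall fun z ↦ ?_)
  simp [modeRe]

/-! ### Waves given by a global representative on an open chart -/

/-- For `ψ = F ∘ Subtype.val` on an open chart `U ⊆ E4`, the extension by zero of `ψ` (in which
`coordEnergyDensity` and `sliceL2NormSq` are written) agrees with `F` on `U`. [folklore] -/
theorem extend_comp_val_apply {U : Opens E4} (F : E4 → ℝ) {z : E4} (hz : z ∈ U) :
    Function.extend Subtype.val (fun x : U ↦ F x) 0 z = F z :=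
  Subtype.val_injective.extend_apply _ _ ⟨z, hz⟩

/-- … hence they agree near every point of `U`. [folklore] -/
theorem extend_comp_val_eventuallyEq {U : Opens E4} (F : E4 → ℝ) {x : E4} (hx : x ∈ U) :
    Function.extend Subtype.val (fun x : U ↦ F x) 0 =ᶠ[𝓝 x] F :=
  Filter.eventuallyEq_of_mem (U.isOpen.mem_nhds hx) fun _ hz ↦ extend_comp_val_apply F hz

/-- … and have the same Fréchet derivative at points of `U`. [folklore] -/
theorem fderiv_extend_comp_val {U : Opens E4} (F : E4 → ℝ) {x : E4} (hx : x ∈ U) :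
    fderiv ℝ (Function.extend Subtype.val (fun x : U ↦ F x) 0) x = fderiv ℝ F x :=
  (extend_comp_val_eventuallyEq F hx).fderiv_eq

/-- The coordinate energy density of `F ∘ Subtype.val` at a point of the open chart `U` is
`Σ_μ (∂_μ F)²`. Dafermos–Rodnianski, arXiv:0811.0354, §4.1. [folklore] -/
theorem coordEnergyDensity_comp_val {U : Opens E4} (F : E4 → ℝ) {x : E4} (hx : x ∈ U) :
    coordEnergyDensity U (fun x : U ↦ F x) x = ∑ ν : Fin 4, (fderiv ℝ F x (E4.basisVector ν)) ^ 2 := by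
  unfold coordEnergyDensity
  rw [fderiv_extend_comp_val F hx]

/-! ### The energy density and the energies of a mode through the leaves `{t_KS = τ}` -/

/-- **The energy density of a mode.** On the leaf `{t_KS = τ}`, at a point `y` of the exterior
slice where the profile is differentiable, the coordinate energy density of
`ψ = Re(e^{−iωt_KS}Φ)` is `e^{2 Im ω τ} · q(−Re ω τ, y)` (`modeDensity`): the printed exact
exponential growth `|∂^αψ(t)| = e^{ε t}|∂^αψ(0)|` of a mode, at the level of the energy density.
SR, CMP 329 (2014), Thm. 1.1. [cite: ShlapentokhRothman2014KleinGordon, Thm. 1.1] -/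
theorem coordEnergyDensity_modeRe {M a : ℝ} (w : ℂ) {Φ : E3 → ℂ} {τ : ℝ} {y : E3}
    (hy : y ∈ Kerr.slice a (Kerr.rPlus M a)) (hΦ : DifferentiableAt ℝ Φ y) :
    coordEnergyDensity (Kerr.exterior M a) (fun x : Kerr.exterior M a ↦ modeRe w Φ x)
        (E4.ofTimeSpace τ y) =
      Real.exp (2 * w.im * τ) * modeDensity w Φ (-(w.re * τ)) y := by
  have hx : E4.ofTimeSpace τ y ∈ Kerr.exterior M a := Kerr.ofTimeSpace_mem_exterior_iff.2 hy
  have hΦ' : DifferentiableAt ℝ Φ (E4.spatial (E4.ofTimeSpace τ y)) := by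
    rwa [E4.spatial_ofTimeSpace]
  rw [coordEnergyDensity_comp_val _ hx, Fin.sum_univ_succ, fderiv_modeRe_basisVector_zero w hΦ']
  simp only [fderiv_modeRe_basisVector_succ w hΦ', E4.spatial_ofTimeSpace,
    E4.ofTimeSpace_apply_zero, exp_phase_eq, modeDensity]
  set r : ℝ := Real.exp (w.im * τ) with hr
  set u : ℂ := Complex.exp (((-(w.re * τ) : ℝ) : ℂ) * Complex.I) with hu
  have hre : ∀ z : ℂ, ((r : ℂ) * z).re = r * z.re := fun z ↦ Complex.re_ofReal_mul r z
  have h1 : -(Complex.I * w) * ((r : ℂ) * u) * Φ y = (r : ℂ) * (-(Complex.I * w) * u * Φ y) := by ring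
  have h2 : ∀ j : Fin 3, (r : ℂ) * u * fderiv ℝ Φ y (EuclideanSpace.single j 1) =
      (r : ℂ) * (u * fderiv ℝ Φ y (EuclideanSpace.single j 1)) := fun j ↦ by ring
  have h3 : Real.exp (2 * w.im * τ) = r * r := by
    rw [hr, ← Real.exp_add]; ring_nf
  simp_rw [h1, h2, hre, h3, mul_pow]
  rw [← Finset.mul_sum]
  ring

/-- The slice `{y | (τ, y) ∈ Kerr.exterior M a}` of the exterior chart at height `τ` is the
exterior slice `Kerr.slice a r₊` (time-translation invariance of `{r > r₊}`; DRSR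
arXiv:1402.7034, §2.1.1). [folklore] -/
theorem setOf_ofTimeSpace_mem_exterior (M a τ : ℝ) :
    {y : E3 | E4.ofTimeSpace τ y ∈ Kerr.exterior M a} = (Kerr.slice a (Kerr.rPlus M a) : Set E3) :=
  Set.ext fun _ ↦ Kerr.ofTimeSpace_mem_exterior_iff

/-- **The energy of a mode through a leaf.** For a profile differentiable on the exterior slice,
`sliceEnergy ψ τ = e^{2 Im ω τ} · ∫_{r > r₊} q(−Re ω τ, y) dy` (in `[0, ∞]`) for
`ψ = Re(e^{−iωt_KS}Φ)`. SR, CMP 329 (2014), Thm. 1.1 and §1.2.2. [cite: ShlapentokhRothman2014KleinGordon, Thm. 1.1 and §1.2.2] -/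
theorem sliceEnergy_modeRe {M a : ℝ} (w : ℂ) {Φ : E3 → ℂ}
    (hΦ : DifferentiableOn ℝ Φ (Kerr.slice a (Kerr.rPlus M a))) (τ : ℝ) :
    sliceEnergy (Kerr.exterior M a) (fun x : Kerr.exterior M a ↦ modeRe w Φ x) τ =
      ENNReal.ofReal (Real.exp (2 * w.im * τ)) *
        ∫⁻ y in (Kerr.slice a (Kerr.rPlus M a) : Set E3),
          ENNReal.ofReal (modeDensity w Φ (-(w.re * τ)) y) := by
  have hmeas : MeasurableSet (Kerr.slice a (Kerr.rPlus M a) : Set E3) :=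
    (Kerr.slice a (Kerr.rPlus M a)).isOpen.measurableSet
  unfold sliceEnergy
  rw [setOf_ofTimeSpace_mem_exterior, lintegral_indicator hmeas,
    ← lintegral_const_mul' _ _ ENNReal.ofReal_ne_top]
  refine setLIntegral_congr_fun hmeas fun y hy ↦ ?_
  rw [coordEnergyDensity_modeRe w hy (hΦ.differentiableAt ((Kerr.slice a _).isOpen.mem_nhds hy)),
    ENNReal.ofReal_mul (Real.exp_pos _).le]

/-- `(Re z)² ≤ ‖z‖²`. [folklore] -/
theorem re_sq_le_norm_sq (z : ℂ) : z.re ^ 2 ≤ ‖z‖ ^ 2 :=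
  calc z.re ^ 2 ≤ z.re ^ 2 + z.im ^ 2 := le_add_of_nonneg_right (sq_nonneg _)
    _ = ‖z‖ ^ 2 := by rw [Complex.sq_norm, Complex.normSq_apply]; ring

/-- **The `L²`-norm of a mode through a leaf** is at most `e^{2 Im ω τ} ∫_{r > r₊} |Φ|²`
(`|Re(e^{−iωτ}Φ)| ≤ e^{Im ω τ}|Φ|`). SR, CMP 329 (2014), §1.2.2 and §2 (the term `∫|R|² r² dr` of
the finite-energy requirement). [cite: ShlapentokhRothman2014KleinGordon, §1.2.2 and §2] -/
theorem sliceL2NormSq_modeRe_le {M a : ℝ} (w : ℂ) (Φ : E3 → ℂ) (τ : ℝ) :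
    sliceL2NormSq (Kerr.exterior M a) (fun x : Kerr.exterior M a ↦ modeRe w Φ x) τ ≤
      ENNReal.ofReal (Real.exp (2 * w.im * τ)) *
        ∫⁻ y in (Kerr.slice a (Kerr.rPlus M a) : Set E3), ENNReal.ofReal (‖Φ y‖ ^ 2) := by
  have hmeas : MeasurableSet (Kerr.slice a (Kerr.rPlus M a) : Set E3) :=
    (Kerr.slice a (Kerr.rPlus M a)).isOpen.measurableSet
  unfold sliceL2NormSq
  rw [setOf_ofTimeSpace_mem_exterior, lintegral_indicator hmeas,
    ← lintegral_const_mul' _ _ ENNReal.ofReal_ne_top]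
  refine setLIntegral_mono' hmeas fun y hy ↦ ?_
  have hx : E4.ofTimeSpace τ y ∈ Kerr.exterior M a := Kerr.ofTimeSpace_mem_exterior_iff.2 hy
  rw [extend_comp_val_apply _ hx, ← ENNReal.ofReal_mul (Real.exp_pos _).le]
  refine ENNReal.ofReal_le_ofReal ?_
  simp only [modeRe, E4.spatial_ofTimeSpace, E4.ofTimeSpace_apply_zero]
  refine (re_sq_le_norm_sq _).trans (le_of_eq ?_)
  have hA : (-(Complex.I * w) * ((τ : ℝ) : ℂ)).re = w.im * τ := by simp
  rw [norm_mul, Complex.norm_exp, mul_pow, sq (Real.exp _), ← Real.exp_add, hA]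
  ring_nf

/-! ### The bound-state majorant: `e^{−κ‖y‖}` is integrable on `ℝ³` -/

/-- For `κ > 0`, `y ↦ e^{−κ‖y‖}` is integrable on `E3 = ℝ³` (comparison with the Japanese bracket
`(1 + ‖y‖)^{−4}`, `integrable_one_add_norm`, via `(κ(1+s))⁴/4! ≤ e^{κ(1+s)}`). This is what makes
"exponentially decaying at infinity" imply "finite energy" for the printed bound states.
SR, CMP 329 (2014), §2 (finite-energy requirement). [folklore] -/
theorem integrable_exp_neg_mul_norm {κ : ℝ} (hκ : 0 < κ) :
    Integrable (fun y : E3 ↦ Real.exp (-(κ * ‖y‖))) := by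
  have h4 : (Module.finrank ℝ E3 : ℝ) < (4 : ℕ) := by
    rw [finrank_euclideanSpace, Fintype.card_fin]; norm_num
  have hint : Integrable (fun y : E3 ↦ 24 * Real.exp κ / κ ^ 4 * (1 + ‖y‖) ^ (-((4 : ℕ) : ℝ))) :=
    (integrable_one_add_norm h4).const_mul _
  refine hint.mono' (by fun_prop) (ae_of_all _ fun y ↦ ?_)
  rw [Real.norm_eq_abs, abs_of_pos (Real.exp_pos _), Real.rpow_neg (by positivity),
    Real.rpow_natCast]
  have hs : 0 ≤ ‖y‖ := norm_nonneg y
  have key : (κ * (1 + ‖y‖)) ^ 4 / 24 ≤ Real.exp (κ * (1 + ‖y‖)) := by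
    have := Real.pow_div_factorial_le_exp (x := κ * (1 + ‖y‖)) (by positivity) 4
    norm_num [Nat.factorial] at this
    exact this
  rw [mul_pow, mul_add, mul_one, Real.exp_add] at key
  have hE : 0 < Real.exp (κ * ‖y‖) := Real.exp_pos _
  have hD : 0 < κ ^ 4 * (1 + ‖y‖) ^ 4 := by positivity
  have hRHS : 24 * Real.exp κ / κ ^ 4 * ((1 + ‖y‖) ^ 4)⁻¹ =
      24 * Real.exp κ / (κ ^ 4 * (1 + ‖y‖) ^ 4) := by
    field_simp
  rw [hRHS, Real.exp_neg, inv_eq_one_div, div_le_div_iff₀ hE hD]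
  linarith [key]

/-! ### The profile energy `Q(θ)`: finiteness, continuity, periodicity, positivity -/

/-- The **profile energy** `Q(θ) = ∫_{Kerr.slice a r₀} q(θ, y) dy` of a mode (a real number; the
integrand is integrable for bound-state profiles, `integrableOn_modeDensity`). SR, CMP 329 (2014),
Thm. 1.1 and §1.2.2. [cite: ShlapentokhRothman2014KleinGordon, Thm. 1.1 and §1.2.2] -/
def modeEnergy (a r₀ : ℝ) (w : ℂ) (Φ : E3 → ℂ) (θ : ℝ) : ℝ :=
  ∫ y in (Kerr.slice a r₀ : Set E3), modeDensity w Φ θ y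

/-- The profile energy is `2π`-periodic. [folklore] -/
theorem modeEnergy_periodic (a r₀ : ℝ) (w : ℂ) (Φ : E3 → ℂ) :
    Function.Periodic (modeEnergy a r₀ w Φ) (2 * π) := by
  intro θ
  unfold modeEnergy
  congr 1
  funext y
  exact modeDensity_periodic w Φ y θ

/-- Pointwise bound-state majorant of the profile density:
`q(θ, y) ≤ (‖ω‖² + 3) (C e^{−κ‖y‖})²` when `|Φ(y)|, ‖DΦ(y)‖ ≤ C e^{−κ‖y‖}`. [folklore] -/
theorem modeDensity_le (w : ℂ) {Φ : E3 → ℂ} (θ : ℝ) {y : E3} {C κ : ℝ}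
    (hΦy : ‖Φ y‖ ≤ C * Real.exp (-(κ * ‖y‖))) (hDΦy : ‖fderiv ℝ Φ y‖ ≤ C * Real.exp (-(κ * ‖y‖))) :
    modeDensity w Φ θ y ≤ (‖w‖ ^ 2 + 3) * (C * Real.exp (-(κ * ‖y‖))) ^ 2 := by
  have hC : 0 ≤ C * Real.exp (-(κ * ‖y‖)) := (norm_nonneg _).trans hΦy
  have hu : ‖Complex.exp ((θ : ℂ) * Complex.I)‖ = 1 := Complex.norm_exp_ofReal_mul_I θ
  have h0 : (-(Complex.I * w) * Complex.exp ((θ : ℂ) * Complex.I) * Φ y).re ^ 2 ≤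
      ‖w‖ ^ 2 * (C * Real.exp (-(κ * ‖y‖))) ^ 2 := by
    refine (re_sq_le_norm_sq _).trans ?_
    rw [norm_mul, norm_mul, norm_neg, norm_mul, Complex.norm_I, one_mul, hu, mul_one, mul_pow]
    gcongr
  have hj : ∀ j : Fin 3,
      (Complex.exp ((θ : ℂ) * Complex.I) * fderiv ℝ Φ y (EuclideanSpace.single j 1)).re ^ 2 ≤
        (C * Real.exp (-(κ * ‖y‖))) ^ 2 := by
    intro j
    refine (re_sq_le_norm_sq _).trans ?_
    rw [norm_mul, hu, one_mul]
    gcongr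
    refine (ContinuousLinearMap.le_opNorm _ _).trans ?_
    rw [PiLp.norm_single, norm_one, mul_one]
    exact hDΦy
  calc modeDensity w Φ θ y ≤ ‖w‖ ^ 2 * (C * Real.exp (-(κ * ‖y‖))) ^ 2 +
        ∑ _j : Fin 3, (C * Real.exp (-(κ * ‖y‖))) ^ 2 := add_le_add h0 (Finset.sum_le_sum fun j _ ↦ hj j)
    _ = (‖w‖ ^ 2 + 3) * (C * Real.exp (-(κ * ‖y‖))) ^ 2 := by simp; ring

/-- The bound-state majorant `(C e^{−κ‖y‖})² = C² e^{−2κ‖y‖}` is integrable on `ℝ³`. [folklore] -/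
theorem integrable_sq_exp_neg_mul_norm (C : ℝ) {κ : ℝ} (hκ : 0 < κ) :
    Integrable (fun y : E3 ↦ (C * Real.exp (-(κ * ‖y‖))) ^ 2) := by
  have h := (integrable_exp_neg_mul_norm (mul_pos two_pos hκ)).const_mul (C ^ 2)
  refine h.congr (ae_of_all _ fun y ↦ ?_)
  simp only [mul_pow]
  rw [sq (Real.exp _), ← Real.exp_add]
  ring_nf

section Profile

variable {a r₀ : ℝ} {w : ℂ} {Φ : E3 → ℂ} {C κ : ℝ}

/-- The profile density is continuous on the slice when the profile is `C¹` there. [folklore] -/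
theorem continuousOn_modeDensity (hΦ : ContDiffOn ℝ 1 Φ (Kerr.slice a r₀)) (θ : ℝ) :
    ContinuousOn (modeDensity w Φ θ) (Kerr.slice a r₀) := by
  have hc : ContinuousOn Φ (Kerr.slice a r₀) := hΦ.continuousOn
  have hD : ContinuousOn (fun y ↦ fderiv ℝ Φ y) (Kerr.slice a r₀) :=
    hΦ.continuousOn_fderiv_of_isOpen (Kerr.slice a r₀).isOpen le_rfl
  have hDj : ∀ j : Fin 3,
      ContinuousOn (fun y ↦ fderiv ℝ Φ y (EuclideanSpace.single j 1)) (Kerr.slice a r₀) :=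
    fun j ↦ hD.clm_apply continuousOn_const
  have h0 : ContinuousOn
      (fun y ↦ (-(Complex.I * w) * Complex.exp ((θ : ℂ) * Complex.I) * Φ y).re) (Kerr.slice a r₀) :=
    Complex.continuous_re.comp_continuousOn (continuousOn_const.mul hc)
  have hj : ∀ j : Fin 3, ContinuousOn (fun y ↦
      (Complex.exp ((θ : ℂ) * Complex.I) * fderiv ℝ Φ y (EuclideanSpace.single j 1)).re)
        (Kerr.slice a r₀) :=
    fun j ↦ Complex.continuous_re.comp_continuousOn (continuousOn_const.mul (hDj j))
  unfold modeDensity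
  exact (h0.pow 2).add (continuousOn_finsetSum _ fun j _ ↦ (hj j).pow 2)

/-- The profile density is continuous in the phase. [folklore] -/
theorem continuous_modeDensity_phase (w : ℂ) (Φ : E3 → ℂ) (y : E3) :
    Continuous fun θ ↦ modeDensity w Φ θ y := by
  unfold modeDensity
  fun_prop

/-- **Finite energy of bound states.** For a `C¹` profile with `|Φ|, ‖DΦ‖ ≤ C e^{−κ‖y‖}` on the
slice, the profile density is integrable on the slice. SR, CMP 329 (2014), §2 (finite-energy
requirement) and the appendix on the local theory of the radial ODE.
[cite: ShlapentokhRothman2014KleinGordon, §2 (finite-energy requirement)] -/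
theorem integrableOn_modeDensity (hκ : 0 < κ) (hΦ : ContDiffOn ℝ 1 Φ (Kerr.slice a r₀))
    (hdec : ∀ y ∈ Kerr.slice a r₀,
      ‖Φ y‖ ≤ C * Real.exp (-(κ * ‖y‖)) ∧ ‖fderiv ℝ Φ y‖ ≤ C * Real.exp (-(κ * ‖y‖)))
    (θ : ℝ) : IntegrableOn (modeDensity w Φ θ) (Kerr.slice a r₀) := by
  have hmeas : MeasurableSet (Kerr.slice a r₀ : Set E3) := (Kerr.slice a r₀).isOpen.measurableSet
  refine Integrable.mono' (((integrable_sq_exp_neg_mul_norm C hκ).const_mul (‖w‖ ^ 2 + 3)).integrableOn)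
    ((continuousOn_modeDensity hΦ θ).aestronglyMeasurable hmeas) ?_
  refine (ae_restrict_iff' hmeas).2 (ae_of_all _ fun y hy ↦ ?_)
  rw [Real.norm_eq_abs, abs_of_nonneg (modeDensity_nonneg _ _ _ _)]
  exact modeDensity_le w θ (hdec y hy).1 (hdec y hy).2

/-- The set integral defining the profile energy, as a lower Lebesgue integral. [folklore] -/
theorem lintegral_modeDensity_eq (hκ : 0 < κ) (hΦ : ContDiffOn ℝ 1 Φ (Kerr.slice a r₀))
    (hdec : ∀ y ∈ Kerr.slice a r₀,
      ‖Φ y‖ ≤ C * Real.exp (-(κ * ‖y‖)) ∧ ‖fderiv ℝ Φ y‖ ≤ C * Real.exp (-(κ * ‖y‖)))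
    (θ : ℝ) :
    ∫⁻ y in (Kerr.slice a r₀ : Set E3), ENNReal.ofReal (modeDensity w Φ θ y) =
      ENNReal.ofReal (modeEnergy a r₀ w Φ θ) :=
  (ofReal_integral_eq_lintegral_ofReal (integrableOn_modeDensity hκ hΦ hdec θ)
    (ae_of_all _ fun y ↦ modeDensity_nonneg w Φ θ y)).symm

/-- The profile energy is continuous in the phase (dominated convergence with the bound-state
majorant). [folklore] -/
theorem continuous_modeEnergy (hκ : 0 < κ) (hΦ : ContDiffOn ℝ 1 Φ (Kerr.slice a r₀))
    (hdec : ∀ y ∈ Kerr.slice a r₀,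
      ‖Φ y‖ ≤ C * Real.exp (-(κ * ‖y‖)) ∧ ‖fderiv ℝ Φ y‖ ≤ C * Real.exp (-(κ * ‖y‖))) :
    Continuous (modeEnergy a r₀ w Φ) := by
  have hmeas : MeasurableSet (Kerr.slice a r₀ : Set E3) := (Kerr.slice a r₀).isOpen.measurableSet
  refine continuous_of_dominated (F := fun θ y ↦ modeDensity w Φ θ y)
    (bound := fun y ↦ (‖w‖ ^ 2 + 3) * (C * Real.exp (-(κ * ‖y‖))) ^ 2)
    (fun θ ↦ (continuousOn_modeDensity hΦ θ).aestronglyMeasurable hmeas) (fun θ ↦ ?_)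
    (((integrable_sq_exp_neg_mul_norm C hκ).const_mul (‖w‖ ^ 2 + 3)).integrableOn)
    (ae_of_all _ fun y ↦ continuous_modeDensity_phase w Φ y)
  refine (ae_restrict_iff' hmeas).2 (ae_of_all _ fun y hy ↦ ?_)
  rw [Real.norm_eq_abs, abs_of_nonneg (modeDensity_nonneg _ _ _ _)]
  exact modeDensity_le w θ (hdec y hy).1 (hdec y hy).2

/-- `Re(−iω z) = Im ω · Re z + Re ω · Im z`. [folklore] -/
theorem re_neg_I_mul_mul (w z : ℂ) : (-(Complex.I * w) * z).re = w.im * z.re + w.re * z.im := by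
  simp [Complex.mul_re, Complex.mul_im]
  ring

/-- **Modes have positive profile energy** (the heart of "exponentially growing" for the energy
form). If `Re ω ≠ 0` and the `C¹` bound-state profile `Φ` does not vanish identically on the
(open, connected: `Kerr.SliceFacts.isConnected_slice`) slice, then `Q(θ) > 0` for every phase:
`Q(θ) = 0` forces `q(θ, ·) = 0` on the slice (continuity), i.e. `∇Re(e^{iθ}Φ) = 0` and
`Re(−iωe^{iθ}Φ) = 0` there; the first makes `Re(e^{iθ}Φ)` constant on the slice, hence `0` by decay
along the end `{‖y‖ > R}` (`Kerr.mem_slice_of_lt_norm`), and then the second reads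
`Re ω · Im(e^{iθ}Φ) = 0`, so `Φ ≡ 0` on the slice. SR, CMP 329 (2014), Thm. 1.1 ("non-zero" solution,
`e^{ε_μ t}|∂^αψ(0)| ≲ |∂^αψ(t)|`). [cite: ShlapentokhRothman2014KleinGordon, Thm. 1.1] -/
theorem modeEnergy_pos [Kerr.SliceFacts] (hw : w.re ≠ 0) (hκ : 0 < κ)
    (hΦ : ContDiffOn ℝ 1 Φ (Kerr.slice a r₀))
    (hdec : ∀ y ∈ Kerr.slice a r₀,
      ‖Φ y‖ ≤ C * Real.exp (-(κ * ‖y‖)) ∧ ‖fderiv ℝ Φ y‖ ≤ C * Real.exp (-(κ * ‖y‖)))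
    (hne : ∃ y ∈ Kerr.slice a r₀, Φ y ≠ 0) (θ : ℝ) : 0 < modeEnergy a r₀ w Φ θ := by
  set S : Opens E3 := Kerr.slice a r₀ with hS_def
  have hS : IsOpen (S : Set E3) := S.isOpen
  have hmeas : MeasurableSet (S : Set E3) := hS.measurableSet
  set u : ℂ := Complex.exp ((θ : ℂ) * Complex.I) with hu_def
  have hu : u ≠ 0 := Complex.exp_ne_zero _
  have hint := integrableOn_modeDensity (w := w) hκ hΦ hdec θ
  by_contra hle
  rw [not_lt] at hle
  have hQ0 : modeEnergy a r₀ w Φ θ = 0 :=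
    le_antisymm hle (setIntegral_nonneg hmeas fun y _ ↦ modeDensity_nonneg w Φ θ y)
  have hae : modeDensity w Φ θ =ᵐ[volume.restrict (S : Set E3)] 0 :=
    (integral_eq_zero_iff_of_nonneg (fun y ↦ modeDensity_nonneg w Φ θ y) hint).1 hQ0
  have hzero : ∀ y ∈ S, modeDensity w Φ θ y = 0 := fun y hy ↦
    Measure.eqOn_open_of_ae_eq hae hS (continuousOn_modeDensity hΦ θ) continuousOn_const hy
  -- the two families of squares vanish on the slice
  have hsq : ∀ y ∈ S, (-(Complex.I * w) * u * Φ y).re = 0 ∧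
      ∀ j : Fin 3, (u * fderiv ℝ Φ y (EuclideanSpace.single j 1)).re = 0 := by
    intro y hy
    have h := hzero y hy
    rw [modeDensity, add_eq_zero_iff_of_nonneg (sq_nonneg _)
      (Finset.sum_nonneg fun _ _ ↦ sq_nonneg _), Finset.sum_eq_zero_iff_of_nonneg
      (fun _ _ ↦ sq_nonneg _)] at h
    exact ⟨pow_eq_zero_iff two_ne_zero |>.1 h.1,
      fun j ↦ pow_eq_zero_iff two_ne_zero |>.1 (h.2 j (Finset.mem_univ j))⟩
  -- `g = Re(u Φ)` has zero gradient on the slice, hence is constant there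
  set g : E3 → ℝ := fun y ↦ (u * Φ y).re with hg_def
  have hΦd : ∀ y ∈ S, DifferentiableAt ℝ Φ y := fun y hy ↦
    (hΦ.differentiableOn one_ne_zero).differentiableAt (hS.mem_nhds hy)
  have hg_deriv : ∀ y ∈ S, HasFDerivAt g (Complex.reCLM.comp (u • fderiv ℝ Φ y)) y := by
    intro y hy
    have h := Complex.reCLM.hasFDerivAt.comp y (((hΦd y hy).hasFDerivAt).const_mul u)
    exact h
  have hg_diff : DifferentiableOn ℝ g S := fun y hy ↦ (hg_deriv y hy).differentiableAt.differentiableWithinAt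
  have hg_fderiv : (S : Set E3).EqOn (fderiv ℝ g) 0 := by
    intro y hy
    rw [(hg_deriv y hy).fderiv, Pi.zero_apply]
    refine ContinuousLinearMap.coe_injective ((EuclideanSpace.basisFun (Fin 3) ℝ).toBasis.ext
      fun j ↦ ?_)
    simpa using (hsq y hy).2 j
  have hg_const : ∀ y ∈ S, ∀ y' ∈ S, g y = g y' := fun y hy y' hy' ↦
    hS.is_const_of_fderiv_eq_zero (Kerr.SliceFacts.isConnected_slice a r₀).isPreconnected
      hg_diff hg_fderiv hy hy'
  -- `g` decays along the end of the slice, so the constant is `0`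
  have hg_bound : ∀ y ∈ S, |g y| ≤ C * Real.exp (-(κ * ‖y‖)) := by
    intro y hy
    refine (Complex.abs_re_le_norm _).trans ?_
    rw [norm_mul, hu_def, Complex.norm_exp_ofReal_mul_I, one_mul]
    exact (hdec y hy).1
  have hg_zero : ∀ y ∈ S, g y = 0 := by
    intro y hy
    by_contra hgy
    have hpos : 0 < |g y| := abs_pos.2 hgy
    have htend : Tendsto (fun t : ℝ ↦ C * Real.exp (-(κ * t))) atTop (𝓝 0) := by
      have h1 : Tendsto (fun t : ℝ ↦ Real.exp (-(κ * t))) atTop (𝓝 0) := by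
        have := Real.tendsto_exp_neg_atTop_nhds_zero.comp (tendsto_id.const_mul_atTop hκ)
        simpa [Function.comp_def] using this
      simpa using h1.const_mul C
    obtain ⟨T, hT⟩ := (htend.eventually (gt_mem_nhds hpos)).exists_forall_of_atTop
    set R : ℝ := max T (Kerr.afRadius a r₀ + 1) with hR_def
    have hR0 : 0 ≤ R := le_max_of_le_right (by linarith [Kerr.afRadius_pos a r₀])
    set y' : E3 := EuclideanSpace.single 0 R with hy'_def
    have hny' : ‖y'‖ = R := by rw [hy'_def, PiLp.norm_single, Real.norm_eq_abs, abs_of_nonneg hR0]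
    have hy'S : y' ∈ S :=
      Kerr.mem_slice_of_lt_norm (by rw [hny']; exact lt_of_lt_of_le (by linarith) (le_max_right _ _))
    have h1 := hT R (le_max_left _ _)
    have h2 := hg_bound y' hy'S
    rw [hny', ← hg_const y hy y' hy'S] at h2
    linarith
  -- with `Re ω ≠ 0`, the profile vanishes on the slice: contradiction
  obtain ⟨y₀, hy₀, hΦy₀⟩ := hne
  have hz : u * Φ y₀ = 0 := by
    have hre : (u * Φ y₀).re = 0 := hg_zero y₀ hy₀
    have him : w.re * (u * Φ y₀).im = 0 := by
      have h := (hsq y₀ hy₀).1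
      rw [mul_assoc, re_neg_I_mul_mul, hre, mul_zero, zero_add] at h
      exact h
    have him' : (u * Φ y₀).im = 0 := (mul_eq_zero.1 him).resolve_left hw
    exact Complex.ext hre him'
  exact hΦy₀ ((mul_eq_zero.1 hz).resolve_left hu)

/-- **Uniform lower bound of the profile energy**: under the hypotheses of `modeEnergy_pos`,
`Q(θ) ≥ c₀ > 0` for all `θ` (continuity, `2π`-periodicity and compactness of `[0, 2π]`). This is
the constant `c` of the exponential lower bound `sliceEnergy ψ τ ≥ c e^{2ετ}`. SR, CMP 329 (2014),
Thm. 1.1. [cite: ShlapentokhRothman2014KleinGordon, Thm. 1.1] -/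
theorem exists_pos_le_modeEnergy [Kerr.SliceFacts] (hw : w.re ≠ 0) (hκ : 0 < κ)
    (hΦ : ContDiffOn ℝ 1 Φ (Kerr.slice a r₀))
    (hdec : ∀ y ∈ Kerr.slice a r₀,
      ‖Φ y‖ ≤ C * Real.exp (-(κ * ‖y‖)) ∧ ‖fderiv ℝ Φ y‖ ≤ C * Real.exp (-(κ * ‖y‖)))
    (hne : ∃ y ∈ Kerr.slice a r₀, Φ y ≠ 0) :
    ∃ c₀ > (0 : ℝ), ∀ θ : ℝ, c₀ ≤ modeEnergy a r₀ w Φ θ := by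
  have hcont := continuous_modeEnergy (w := w) hκ hΦ hdec
  obtain ⟨θ₀, -, hmin⟩ := isCompact_Icc.exists_isMinOn (nonempty_Icc.2 Real.two_pi_pos.le)
    (hcont.continuousOn (s := Icc 0 (2 * π)))
  refine ⟨modeEnergy a r₀ w Φ θ₀, modeEnergy_pos hw hκ hΦ hdec hne θ₀, fun θ ↦ ?_⟩
  obtain ⟨θ', hθ', heq⟩ := (modeEnergy_periodic a r₀ w Φ).exists_mem_Ico₀ Real.two_pi_pos θ
  rw [heq]
  exact isMinOn_iff.1 hmin θ' (Ico_subset_Icc_self hθ')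

end Profile

/-! ### One bound-state mode gives the barrier data (Theorem 1.2 ⟹ Theorem 1.1, energy form) -/

/-- **One bound-state mode gives the data of the barrier fact** — the step "Theorem 1.2 ⟹
Theorem 1.1" of Shlapentokh-Rothman for the vendored energy form of Theorem 1.1, at fixed
parameters. Let `μ ≠ 0`, `ω ∈ ℂ` with `Re ω ≠ 0`, and let `Φ : E3 → ℂ` be `C^∞` on the exterior
slice `Kerr.slice a r₊`, not identically zero there, with the bound-state estimate
`‖Φ(y)‖, ‖DΦ(y)‖ ≤ C e^{−κ‖y‖}` (`κ > 0`) on the slice. Then the real mode `ψ = Re(e^{−iωt_KS}Φ)`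
(`modeRe`) is `C^∞` on the exterior chart (`contDiffAt_modeRe`, `OpensChart.contMDiffAt_iff`), has
finite Klein–Gordon energy `kgSliceEnergy ψ τ μ < ∞` on every leaf `{t_KS = τ}`
(`sliceEnergy_modeRe`, `sliceL2NormSq_modeRe_le`, integrability of the bound-state majorant), and
`sliceEnergy ψ τ = e^{2 Im ω τ} Q(−Re ω τ) ≥ c₀ e^{2 Im ω τ}` for all `τ` with some `c₀ > 0`
(`exists_pos_le_modeEnergy`) — for `Im ω > 0` the printed exponential growth
"`e^{ε_μ t}|∂^αψ(0)| ≲ |∂^αψ(t)|`" at the level of the energy. The equation plays no role here; the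
modes of Thm. 1.2, read in the ingoing Kerr–Schild chart (`t* = t_KS + r + const`,
Dafermos–Rodnianski arXiv:0811.0354 §5.1), satisfy these hypotheses (§2 and the appendix on the local
theory of the radial ODE; `ShlapentokhRothman2014_unstableModeProfile`). Shlapentokh-Rothman, CMP 329
(2014), Thm. 1.1 from Thm. 1.2. [cite: ShlapentokhRothman2014KleinGordon, Thm. 1.1 and Thm. 1.2] -/
theorem exists_sliceEnergy_growth_of_mode [Kerr.SliceFacts] {M a μ : ℝ} (hμ : μ ≠ 0) {w : ℂ}
    (hwre : w.re ≠ 0) {Φ : E3 → ℂ} (hΦ : ContDiffOn ℝ ∞ Φ (Kerr.slice a (Kerr.rPlus M a)))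
    (hne : ∃ y ∈ Kerr.slice a (Kerr.rPlus M a), Φ y ≠ 0) {C κ : ℝ} (hκ : 0 < κ)
    (hdec : ∀ y ∈ Kerr.slice a (Kerr.rPlus M a),
      ‖Φ y‖ ≤ C * Real.exp (-(κ * ‖y‖)) ∧ ‖fderiv ℝ Φ y‖ ≤ C * Real.exp (-(κ * ‖y‖))) :
    ∃ c₀ > (0 : ℝ),
      ContMDiff 𝓘(ℝ, E4) 𝓘(ℝ, ℝ) ∞ (fun x : Kerr.exterior M a ↦ modeRe w Φ x) ∧
      (∀ τ : ℝ, kgSliceEnergy (Kerr.exterior M a) (fun x : Kerr.exterior M a ↦ modeRe w Φ x) τ μ < ⊤) ∧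
      ∀ τ : ℝ, ENNReal.ofReal (c₀ * Real.exp (2 * w.im * τ)) ≤
        sliceEnergy (Kerr.exterior M a) (fun x : Kerr.exterior M a ↦ modeRe w Φ x) τ := by
  have hΦ1 : ContDiffOn ℝ 1 Φ (Kerr.slice a (Kerr.rPlus M a)) := hΦ.of_le (by exact_mod_cast le_top)
  obtain ⟨c₀, hc₀, hQ⟩ := exists_pos_le_modeEnergy hwre hκ hΦ1 hdec hne
  have hS : IsOpen (Kerr.slice a (Kerr.rPlus M a) : Set E3) := (Kerr.slice a _).isOpen
  refine ⟨c₀, hc₀, fun x ↦ ?_, fun τ ↦ ?_, fun τ ↦ ?_⟩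
  · -- smoothness
    refine (OpensChart.contMDiffAt_iff x _ (modeRe w Φ) (fun _ ↦ rfl)).2 (contDiffAt_modeRe w ?_)
    have hy : E4.spatial x.1 ∈ Kerr.slice a (Kerr.rPlus M a) := by
      rw [← Kerr.ofTimeSpace_mem_exterior_iff (t := E4.time x.1), E4.ofTimeSpace_time_spatial]
      exact x.2
    exact hΦ.contDiffAt (hS.mem_nhds hy)
  · -- finite Klein–Gordon energy on the leaf `{t_KS = τ}`
    rw [kgSliceEnergy_lt_top_iff _ _ _ hμ, sliceEnergy_modeRe w (hΦ1.differentiableOn one_ne_zero),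
      lintegral_modeDensity_eq hκ hΦ1 hdec]
    refine ⟨ENNReal.mul_lt_top ENNReal.ofReal_lt_top ENNReal.ofReal_lt_top,
      (sliceL2NormSq_modeRe_le w Φ τ).trans_lt (ENNReal.mul_lt_top ENNReal.ofReal_lt_top ?_)⟩
    refine lt_of_le_of_lt (setLIntegral_mono' hS.measurableSet fun y hy ↦
      ENNReal.ofReal_le_ofReal ?_) ((integrable_sq_exp_neg_mul_norm C hκ).integrableOn.lintegral_lt_top)
    exact pow_le_pow_left₀ (norm_nonneg _) (hdec y hy).1 2
  · -- exponential lower bound of the first-order energy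
    rw [sliceEnergy_modeRe w (hΦ1.differentiableOn one_ne_zero), lintegral_modeDensity_eq hκ hΦ1 hdec,
      ← ENNReal.ofReal_mul (Real.exp_pos _).le, mul_comm]
    exact ENNReal.ofReal_le_ofReal (mul_le_mul_of_nonneg_left (hQ _) (Real.exp_pos _).le)

/-! ### The stationary reduction: a mode solves `□_g ψ = μ²ψ` iff its profile solves the reduced
### (time-Fourier-transformed) equation on the leaf — the "if" direction, proved -/

/-- The **complex Kerr–Schild-chart mode** `Ψ(x) = e^{−iω x⁰} G(x¹, x², x³)` with profile
`G : E3 → ℂ` (`modeRe ω Φ = Re ∘ modeC ω Φ`). SR, CMP 329 (2014), §1.3 (1.5).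
[cite: ShlapentokhRothman2014KleinGordon, §1.3 (1.5)] -/
def modeC (w : ℂ) (G : E3 → ℂ) (x : E4) : ℂ :=
  Complex.exp (-(Complex.I * w) * ((x 0 : ℝ) : ℂ)) * G (E4.spatial x)

/-- `Re(modeC ω Φ) = modeRe ω Φ` (definitional). [folklore] -/
@[simp]
theorem modeC_re (w : ℂ) (Φ : E3 → ℂ) (x : E4) : (modeC w Φ x).re = modeRe w Φ x := rfl

/-- Derivative of the complex mode (product and chain rules; the complex analogue of
`hasFDerivAt_modeRe`). [folklore] -/
theorem hasFDerivAt_modeC (w : ℂ) {G : E3 → ℂ} {G' : E3 →L[ℝ] ℂ} {x : E4}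
    (hG : HasFDerivAt G G' (E4.spatial x)) :
    HasFDerivAt (modeC w G)
      (Complex.exp (-(Complex.I * w) * ((x 0 : ℝ) : ℂ)) • (G'.comp E4.spatial) +
        G (E4.spatial x) • (Complex.exp (-(Complex.I * w) * ((x 0 : ℝ) : ℂ)) • phaseCLM w)) x := by
  have hE : HasFDerivAt (fun x : E4 ↦ Complex.exp (-(Complex.I * w) * ((x 0 : ℝ) : ℂ)))
      (Complex.exp (-(Complex.I * w) * ((x 0 : ℝ) : ℂ)) • phaseCLM w) x := by
    have h := (Complex.hasDerivAt_exp (phaseCLM w x)).comp_hasFDerivAt x (phaseCLM w).hasFDerivAt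
    simp only [phaseCLM_apply] at h
    refine h.congr_of_eventuallyEq (Eventually.of_forall fun z ↦ ?_)
    simp
  have hG' : HasFDerivAt (fun x : E4 ↦ G (E4.spatial x)) (G'.comp E4.spatial) x :=
    hG.comp x E4.spatial.hasFDerivAt
  exact hE.mul hG'

/-- `∂₀` of the complex mode: `∂_{t_KS}(e^{−iωt_KS}G(y)) = −iω e^{−iωt_KS} G(y)`. [folklore] -/
theorem fderiv_modeC_basisVector_zero (w : ℂ) {G : E3 → ℂ} {x : E4}
    (hG : DifferentiableAt ℝ G (E4.spatial x)) :
    fderiv ℝ (modeC w G) x (E4.basisVector 0) =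
      -(Complex.I * w) * Complex.exp (-(Complex.I * w) * ((x 0 : ℝ) : ℂ)) * G (E4.spatial x) := by
  rw [(hasFDerivAt_modeC w hG.hasFDerivAt).fderiv]
  simp
  ring

/-- `∂_{j+1}` of the complex mode: `∂_{y_j}(e^{−iωt_KS}G(y)) = e^{−iωt_KS} ∂_jG(y)`. [folklore] -/
theorem fderiv_modeC_basisVector_succ (w : ℂ) {G : E3 → ℂ} {x : E4}
    (hG : DifferentiableAt ℝ G (E4.spatial x)) (j : Fin 3) :
    fderiv ℝ (modeC w G) x (E4.basisVector j.succ) =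
      Complex.exp (-(Complex.I * w) * ((x 0 : ℝ) : ℂ)) *
        fderiv ℝ G (E4.spatial x) (EuclideanSpace.single j 1) := by
  rw [(hasFDerivAt_modeC w hG.hasFDerivAt).fderiv]
  simp [Fin.succ_ne_zero]

/-- Real parts commute with real Fréchet derivatives: `D(Re f)(x) v = Re(Df(x) v)`. [folklore] -/
theorem fderiv_re_apply {f : E4 → ℂ} {x : E4} (hf : DifferentiableAt ℝ f x) (v : E4) :
    fderiv ℝ (fun x ↦ (f x).re) x v = (fderiv ℝ f x v).re := by
  have h : HasFDerivAt (fun x ↦ (f x).re) (Complex.reCLM.comp (fderiv ℝ f x)) x := by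
    have := Complex.reCLM.hasFDerivAt.comp x hf.hasFDerivAt
    simpa [Function.comp_def] using this
  rw [h.fderiv]
  simp

/-- **Stationarity of the inverse Kerr metric along the leaves**: `g^{μν}(t, y) = g^{μν}(0, y)`
(`∂_{t_KS} g^{μν} = 0`, `Kerr.inverseMetric_add_smul_basisVector_zero`). Kerr–Schild 1965, §2.
[folklore] -/
theorem inverseMetric_ofTimeSpace (M a t : ℝ) (y : E3) (μ ν : Fin 4) :
    Kerr.inverseMetric M a (E4.ofTimeSpace t y) μ ν =
      Kerr.inverseMetric M a (E4.ofTimeSpace 0 y) μ ν := by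
  have h : E4.ofTimeSpace t y = E4.ofTimeSpace 0 y + t • E4.basisVector 0 := by
    rw [E4.ofTimeSpace_eq_smul_add' t, E4.ofTimeSpace_eq_smul_add' 0, zero_smul, zero_add, add_comm]
  rw [h, Kerr.inverseMetric_add_smul_basisVector_zero]

/-- The **flux of a mode**: `G^μ(y) = g^{μ0}(0,y)(−iω Φ(y)) + Σ_k g^{μ,k+1}(0,y) ∂_kΦ(y)`, so that
`Σ_ν g^{μν} ∂_ν(e^{−iωt_KS}Φ) = e^{−iωt_KS} G^μ(y)` (`sum_inverseMetric_mul_fderiv_modeRe`), with the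
components `g^{μν} = η^{μν} − 2Hℓ^μℓ^ν` of the inverse Kerr metric in ingoing Kerr–Schild coordinates
(`Kerr.inverseMetric`) on the leaf `{t_KS = 0}`. This is `∂_t ↦ −iω` in the flux `g^{μν}∂_νψ`; SR,
CMP 329 (2014), §1.3 (modes) with Kerr–Schild 1965, §2 (the components). [cite: ShlapentokhRothman2014KleinGordon, §1.3] -/
def modeFlux (M a : ℝ) (w : ℂ) (Φ : E3 → ℂ) (μ : Fin 4) (y : E3) : ℂ :=
  (Kerr.inverseMetric M a (E4.ofTimeSpace 0 y) μ 0 : ℂ) * (-(Complex.I * w) * Φ y) +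
    ∑ k : Fin 3, (Kerr.inverseMetric M a (E4.ofTimeSpace 0 y) μ k.succ : ℂ) *
      fderiv ℝ Φ y (EuclideanSpace.single k 1)

/-- The **reduced (stationary) wave operator** of the Kerr metric at frequency `ω`, acting on
profiles `Φ : E3 → ℂ` on the leaf: `P_ω Φ = −iω G⁰ + Σ_j ∂_j G^{j+1}`, `G^μ = modeFlux`, i.e. the
divergence form `□_g = Σ_μ ∂_μ(g^{μν}∂_ν ·)` of the wave operator in the unimodular, stationary
ingoing Kerr–Schild chart (`Kerr.dalembertian_eq_divergence`) with `∂_{t_KS} ↦ −iω`: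
`□_g(e^{−iωt_KS}Φ) = e^{−iωt_KS} P_ω Φ` for the complex-linear extension of `□_g`, so a complex mode
solves `(□_g − μ²)ψ = 0` iff its profile solves `P_ω Φ = μ² Φ`; proved here is what the reduction
needs, `□_g Re(e^{−iωt_KS}Φ) = Re(e^{−iωt_KS} P_ω Φ)` (`dalembertian_modeRe`). SR, CMP 329 (2014), §1.3
and §2 (mode solutions; there the reduced equation is further separated in `(r, θ, φ)`, (2.1)–(2.2);
`∂_t` of Boyer–Lindquist coordinates is `∂_{t*}`, §1.2.1, `= ∂_{t_KS}`).
[cite: ShlapentokhRothman2014KleinGordon, §1.3 and §2] -/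
def reducedWaveOp (M a : ℝ) (w : ℂ) (Φ : E3 → ℂ) (y : E3) : ℂ :=
  -(Complex.I * w) * modeFlux M a w Φ 0 y +
    ∑ j : Fin 3, fderiv ℝ (modeFlux M a w Φ j.succ) y (EuclideanSpace.single j 1)

/-- **The flux of a mode is a mode**: at a point `x` where the profile is differentiable,
`Σ_ν g^{μν}(x) ∂_ν Re(e^{−iωt_KS}Φ)(x) = Re(e^{−iωx⁰} G^μ(x¹, x², x³))` (stationarity of `g^{μν}`
and `∂₀ ↦ −iω`). [folklore] -/
theorem sum_inverseMetric_mul_fderiv_modeRe (M a : ℝ) (w : ℂ) {Φ : E3 → ℂ} {x : E4}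
    (hΦ : DifferentiableAt ℝ Φ (E4.spatial x)) (μ : Fin 4) :
    ∑ ν, Kerr.inverseMetric M a x μ ν * fderiv ℝ (modeRe w Φ) x (E4.basisVector ν) =
      (modeC w (modeFlux M a w Φ μ) x).re := by
  have hx : x = E4.ofTimeSpace (x 0) (E4.spatial x) := (E4.ofTimeSpace_time_spatial x).symm
  have hg : ∀ ν, Kerr.inverseMetric M a x μ ν =
      Kerr.inverseMetric M a (E4.ofTimeSpace 0 (E4.spatial x)) μ ν := by
    intro ν
    conv_lhs => rw [hx]
    exact inverseMetric_ofTimeSpace M a _ _ μ ν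
  set E : ℂ := Complex.exp (-(Complex.I * w) * ((x 0 : ℝ) : ℂ)) with hE_def
  rw [Fin.sum_univ_succ, fderiv_modeRe_basisVector_zero w hΦ]
  simp only [fderiv_modeRe_basisVector_succ w hΦ, hg, modeC, modeFlux, mul_add, Complex.add_re,
    Finset.mul_sum, Complex.re_sum, ← hE_def]
  congr 1
  · rw [show E * ((Kerr.inverseMetric M a (E4.ofTimeSpace 0 (E4.spatial x)) μ 0 : ℂ) *
        (-(Complex.I * w) * Φ (E4.spatial x))) =
        (Kerr.inverseMetric M a (E4.ofTimeSpace 0 (E4.spatial x)) μ 0 : ℂ) *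
          (-(Complex.I * w) * E * Φ (E4.spatial x)) by ring, Complex.re_ofReal_mul]
  · refine Finset.sum_congr rfl fun k _ ↦ ?_
    rw [show E * ((Kerr.inverseMetric M a (E4.ofTimeSpace 0 (E4.spatial x)) μ k.succ : ℂ) *
        fderiv ℝ Φ (E4.spatial x) (EuclideanSpace.single k 1)) =
        (Kerr.inverseMetric M a (E4.ofTimeSpace 0 (E4.spatial x)) μ k.succ : ℂ) *
          (E * fderiv ℝ Φ (E4.spatial x) (EuclideanSpace.single k 1)) by ring, Complex.re_ofReal_mul]

/-- The flux profile `G^μ` is differentiable at points of `{r > 0}` where the profile is `C²`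
(the components `g^{μν}(0, ·)` are smooth there, `Kerr.contDiffAt_inverseMetric`). [folklore] -/
theorem differentiableAt_modeFlux (M a : ℝ) (w : ℂ) {Φ : E3 → ℂ} {y : E3}
    (hr : 0 < Kerr.radius a (E4.ofTimeSpace 0 y)) (hΦ : ContDiffAt ℝ 2 Φ y) (μ : Fin 4) :
    DifferentiableAt ℝ (modeFlux M a w Φ μ) y := by
  have hg : ∀ ν, DifferentiableAt ℝ
      (fun y ↦ (Kerr.inverseMetric M a (E4.ofTimeSpace 0 y) μ ν : ℂ)) y := by
    intro ν
    have h1 : DifferentiableAt ℝ (fun y ↦ Kerr.inverseMetric M a (E4.ofTimeSpace 0 y) μ ν) y :=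
      ((Kerr.contDiffAt_inverseMetric M a hr μ ν (n := 1)).differentiableAt one_ne_zero).comp y
        (E4.hasFDerivAt_ofTimeSpace 0 y).differentiableAt
    exact Complex.ofRealCLM.differentiableAt.comp y h1
  have hΦ1 : DifferentiableAt ℝ Φ y := hΦ.differentiableAt (by norm_num)
  have hΦ2 : DifferentiableAt ℝ (fderiv ℝ Φ) y :=
    (hΦ.fderiv_right (m := 1) le_rfl).differentiableAt one_ne_zero
  have hD : ∀ k : Fin 3,
      DifferentiableAt ℝ (fun y ↦ fderiv ℝ Φ y (EuclideanSpace.single k 1)) y :=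
    fun k ↦ hΦ2.clm_apply (differentiableAt_const _)
  unfold modeFlux
  exact ((hg 0).mul (hΦ1.const_mul _)).add
    (DifferentiableAt.fun_sum fun k _ ↦ (hg k.succ).mul (hD k))

/-- **The wave operator on a mode is the reduced operator on its profile**: for a profile `Φ`
which is `C^∞` on the exterior slice and `ψ = Re(e^{−iωt_KS}Φ)`,
`□_g ψ (x) = Re(e^{−iωx⁰} (P_ω Φ)(x¹, x², x³))` at every point of
`Kerr.exterior M a = Kerr.region a r₊`
(divergence form of `□_g` in the unimodular chart, `Kerr.dalembertian_eq_divergence`; stationarity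
`inverseMetric_ofTimeSpace`; `∂₀ e^{−iωt_KS} = −iω e^{−iωt_KS}`; real coefficients commute with
`Re`). SR, CMP 329 (2014), §1.3 and §2 (mode solutions); Kerr–Schild 1965, §2.
[cite: ShlapentokhRothman2014KleinGordon, §1.3 and §2] -/
theorem dalembertian_modeRe [Kerr.Facts] [Kerr.SliceFacts] {M a : ℝ} (w : ℂ) {Φ : E3 → ℂ}
    (hΦ : ContDiffOn ℝ ∞ Φ (Kerr.slice a (Kerr.rPlus M a))) (x : Kerr.region a (Kerr.rPlus M a)) :
    (Kerr.smoothMetric M a (Kerr.rPlus M a)).toPseudoRiemannianMetric.dalembertian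
        (fun x : Kerr.region a (Kerr.rPlus M a) ↦ modeRe w Φ x) x =
      (modeC w (reducedWaveOp M a w Φ) x).re := by
  set S : Opens E3 := Kerr.slice a (Kerr.rPlus M a) with hS_def
  have hS : IsOpen (S : Set E3) := S.isOpen
  -- the profile is `C²` at the spatial parts of exterior points, which have `r > 0`
  have hmemS : ∀ z : E4, z ∈ Kerr.region a (Kerr.rPlus M a) → E4.spatial z ∈ S := by
    intro z hz
    rw [hS_def, ← Kerr.ofTimeSpace_mem_region_iff (t := E4.time z), E4.ofTimeSpace_time_spatial]
    exact hz
  have hΦ2 : ∀ z : E4, z ∈ Kerr.region a (Kerr.rPlus M a) → ContDiffAt ℝ 2 Φ (E4.spatial z) :=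
    fun z hz ↦ (hΦ.contDiffAt (hS.mem_nhds (hmemS z hz))).of_le (WithTop.coe_le_coe.2 le_top)
  have hrad : ∀ z : E4, z ∈ Kerr.region a (Kerr.rPlus M a) →
      0 < Kerr.radius a (E4.ofTimeSpace 0 (E4.spatial z)) := fun z hz ↦
    Kerr.radius_pos_of_mem_region (Kerr.mem_slice_iff_ofTimeSpace_mem_region.1 (hmemS z hz))
  have hrep : ContDiffAt ℝ 2 (modeRe w Φ) x.1 := contDiffAt_modeRe w (hΦ2 x.1 x.2)
  rw [Kerr.dalembertian_eq_divergence M a (Kerr.rPlus M a)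
    (ψ := fun x : Kerr.region a (Kerr.rPlus M a) ↦ modeRe w Φ x) (fun _ ↦ rfl) x hrep]
  -- each flux `Σ_ν g^{μν} ∂_ν ψ` is the real mode with profile `G^μ`, near `x`
  have hflux : ∀ μ, (fun z : E4 ↦ ∑ ν, Kerr.inverseMetric M a z μ ν *
      fderiv ℝ (modeRe w Φ) z (E4.basisVector ν)) =ᶠ[𝓝 (x.1 : E4)]
        fun z ↦ (modeC w (modeFlux M a w Φ μ) z).re := by
    intro μ
    filter_upwards [(Kerr.region a (Kerr.rPlus M a)).isOpen.mem_nhds x.2] with z hz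
    exact sum_inverseMetric_mul_fderiv_modeRe M a w ((hΦ2 z hz).differentiableAt (by norm_num)) μ
  have hGd : ∀ μ, DifferentiableAt ℝ (modeFlux M a w Φ μ) (E4.spatial x.1) := fun μ ↦
    differentiableAt_modeFlux M a w (hrad x.1 x.2) (hΦ2 x.1 x.2) μ
  have hCd : ∀ μ, DifferentiableAt ℝ (modeC w (modeFlux M a w Φ μ)) x.1 := fun μ ↦
    (hasFDerivAt_modeC w (hGd μ).hasFDerivAt).differentiableAt
  have hterm : ∀ μ, fderiv ℝ (fun z : E4 ↦ ∑ ν, Kerr.inverseMetric M a z μ ν *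
      fderiv ℝ (modeRe w Φ) z (E4.basisVector ν)) x.1 (E4.basisVector μ) =
      (fderiv ℝ (modeC w (modeFlux M a w Φ μ)) x.1 (E4.basisVector μ)).re := by
    intro μ
    rw [(hflux μ).fderiv_eq, fderiv_re_apply (hCd μ)]
  have hsucc : ∀ j : Fin 3,
      fderiv ℝ (modeC w (modeFlux M a w Φ j.succ)) x.1 (E4.basisVector j.succ) =
        Complex.exp (-(Complex.I * w) * ((x.1 0 : ℝ) : ℂ)) *
          fderiv ℝ (modeFlux M a w Φ j.succ) (E4.spatial x.1) (EuclideanSpace.single j 1) :=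
    fun j ↦ fderiv_modeC_basisVector_succ w (hGd j.succ) j
  rw [Finset.sum_congr rfl fun μ _ ↦ hterm μ, Fin.sum_univ_succ,
    fderiv_modeC_basisVector_zero w (hGd 0)]
  simp only [hsucc, modeC, reducedWaveOp, mul_add, Complex.add_re, Finset.mul_sum, Complex.re_sum]
  congr 1
  ring_nf

/-- **Shlapentokh-Rothman's mode theorem (unstable Klein–Gordon modes on sub-extremal Kerr), profile
(stationary Kerr–Schild-chart) form.** Shlapentokh-Rothman, Comm. Math. Phys. 329 (2014), Thm. 1.2,
as printed: "Fix a sub-extremal Kerr spacetime with mass `M` and angular momentum `aM`. Let `m ∈ ℤ`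
and `ω₀ ∈ ℝ` satisfy `am − 2Mr₊ω₀ = 0` and `am ≠ 0`. Then, for each `l` and sufficiently small
`δ > 0`, there exists `μ(0) > |ω_R(0)|`, real analytic `ω_R(ε)`, and real analytic `μ(ε)` such that
for every `−δ < ε < δ`, there exists a mode solution with parameters `(ω_R(ε) + iε, m, l, μ(ε))`.
These unstable modes must all be superradiant `|am| − 2Mr₊√(ω_R²(ε) + ε²) > 0`. Lastly, the modes
lose mass as they become unstable `∂μ/∂ε(0) < 0`." Here (§1.3, §2) a *mode solution* with
parameters `(ω, m, l, μ)` is `ψ = e^{−iωt}e^{imφ}S_{ml}(θ)R(r)` in Boyer–Lindquist coordinates,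
`S_{ml}` an eigenfunction of the angular ODE (2.1) with `e^{imφ}S_{ml}` smooth on `𝕊²`, `R` a
solution of the radial ODE (2.2) which is regular at the horizon — `R = (r − r₊)^ξ ρ(r)`, `ρ`
smooth, equivalently `ψ = e^{−iωt*}e^{imφ*}S_{ml}(θ)f(r)` with `f` smooth up to `r₊` in Kerr-star
coordinates, so that "`ψ` extends smoothly to the horizon" — and has finite energy,
`∫_{r₊+1}^∞ (|R|² + |R'|²) r² dr < ∞`, whence (third appendix, *Local theory for the radial ODE*,
Lemma 9.1 in the numbering of the held copy `paper:arxiv-1302.3448`; §4.2: "if a solution of the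
radial ODE is not exponentially decreasing, then it is exponentially increasing") `R` and `R'` are
exponentially decaying at infinity, `R ~ e^{−√(μ²−ω²) r} r^{−1−M(2ω²−μ²)/√(μ²−ω²)}`. Mass clause
(Thm. 1.1 and abstract): "For every non-zero integer `m`, `μ` can be chosen arbitrarily close to
`|am|/(2Mr₊)`" (from Thm. 1.3 (3): real modes have `ω² < μ² < ω² + C(m, l)`, `C(m, l) → 0` as
`l → ∞`, and `μ(ε) → μ(0)`). In the stationary ingoing Kerr–Schild chart of the prelude
(`∂_t = ∂_{t*} = ∂_{t_KS}`, §1.2.1) a mode solution of `(□_g − μ²)ψ = 0` is `e^{−iωt_KS}Φ(y)` with a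
profile `Φ` solving the reduced equation `P_ω Φ = μ² Φ` on the leaf (`reducedWaveOp`: the
divergence form of `□_g` with `∂_{t_KS} ↦ −iω`; the paper separates this equation further in
`(r, θ, φ)`, §2 (2.1)–(2.2)).

**Vendored form** (existence, at one small `ε > 0`, in the ingoing Kerr–Schild chart of the prelude,
conventions of `KleinGordonSuperradiantInstability.lean`): for `[Kerr.Facts] [Kerr.SliceFacts]`,
`0 < |a| < M` (`Kerr.IsSubextremal M a`, `a ≠ 0`), every non-zero integer `m` and every `δ > 0`
there are a mass `μ > 0` with `|μ − |am|/(2Mr₊)| < δ`, a frequency `ω ∈ ℂ` with `Im ω > 0`,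
`Re ω ≠ 0` and `2Mr₊‖ω‖ < |am|`, and a profile `Φ : E3 → ℂ` which is `C^∞` on the exterior slice
`Kerr.slice a r₊ = {y | r(0, y) > r₊}`, does not vanish identically there, satisfies the bound-state
estimate `‖Φ(y)‖ ≤ C e^{−κ‖y‖}`, `‖DΦ(y)‖ ≤ C e^{−κ‖y‖}` on the slice for some `C` and `κ > 0`, and
solves `P_ω Φ (y) = μ² Φ(y)` at every `y ∈ Kerr.slice a r₊`.

Rendering (every deviation from the printed wording): (i) *coordinates* — the printed mode, smooth
on the domain of outer communications and across `𝓗⁺` in `(t*, r, θ, φ*)`, is `e^{−iωt_KS} Φ(y)`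
in the ingoing Kerr–Schild chart because `t* = t_KS + r + const` and `φ*`, `φ_KS` differ by a
constant (Dafermos–Rodnianski, arXiv:0811.0354, §5.1; SR §1.2.1), with
`Φ = e^{−iω(r + const)} e^{imφ*} S_{ml}(θ) f(r)` read in the Cartesian coordinates `y` of the leaf
`{t_KS = 0}`, a `C^∞` function on `{r > r₊}`; (ii) *profile equation, real part* — the
coefficients of `□_g` in this chart are real and `t_KS`-independent, so `□_g` maps the mode
`e^{−iωt_KS}Φ` to the mode with profile `P_ω Φ` (`dalembertian_modeRe`:
`□_g Re(e^{−iωt_KS}Φ) = Re(e^{−iωt_KS} P_ω Φ)`, proved) and the printed equation `(□_g − μ²)ψ = 0`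
for the mode is the profile equation `P_ω Φ = μ² Φ` stated here, from which the real solution
`Re ψ` of `□_g Re ψ = μ² Re ψ` used by the barrier is obtained (`dalembertian_modeRe_of_reducedWaveOp`,
proved); (iii) *decay* — on the
slice `|Φ| = e^{Im ω (r + const)} |S_{ml}| |f|` with `|f| = e^{−Im ω · t̄(r)}|R|`, `t̄ = r* + const`,
`r − r* = −2M log r + O(1)`, so `|Φ| ≲ r^{−2M Im ω}|R| ≲ e^{−κ r}` for any `κ < Re√(μ² − ω²)`
(`> 0` off the cut `μ² − ω² ∉ (−∞, 0]`, Lemma 9.1 of the held copy), and likewise for `DΦ` (`R'`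
decays at the same rate; the coordinate change `(r, θ, φ) ↦ y` has bounded inverse Jacobian on
`{r ≥ r₊}`), while near `𝓗⁺` boundedness of `Φ`, `DΦ` on the open slice is the printed smooth
extension across `r = r₊`; `r ≤ ‖y‖ ≤ √(r² + a²)`; (iv) *`Re ω ≠ 0`, `Im ω > 0`* — the fact is
Thm. 1.2 at one `ε ∈ (0, δ)` small enough that `ω_R(ε) ≠ 0`, available since `ω_R` is real analytic
with `ω_R(0) = ω₀ = am/(2Mr₊) ≠ 0`; (v) *not vendored* — the analytic one-parameter families, all
`l`, `∂μ/∂ε(0) < 0`, the mode structure of `Φ` and the pointwise bounds of Thm. 1.1. It implies the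
barrier (`KleinGordonSuperradiantInstability.of_unstableModeProfile`, proved below from
`exists_sliceEnergy_growth_of_mode` and `dalembertian_modeRe_of_reducedWaveOp`).
[cite: ShlapentokhRothman2014KleinGordon, Thm. 1.2 with §2 (mode solutions, (2.1)–(2.4)) and the appendix "Local theory for the radial ODE" (Lemma 9.1 of the held copy); mass clause Thm. 1.1 and abstract] -/
def ShlapentokhRothman2014_unstableModeProfile : Prop :=
  ∀ [Kerr.Facts] [Kerr.SliceFacts] (M a : ℝ), Kerr.IsSubextremal M a → a ≠ 0 →
    ∀ m : ℤ, m ≠ 0 → ∀ δ > (0 : ℝ),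
    ∃ μ > (0 : ℝ), |μ - |a * m| / (2 * M * Kerr.rPlus M a)| < δ ∧
    ∃ w : ℂ, 0 < w.im ∧ w.re ≠ 0 ∧ 2 * M * Kerr.rPlus M a * ‖w‖ < |a * m| ∧
    ∃ Φ : E3 → ℂ, ContDiffOn ℝ ∞ Φ (Kerr.slice a (Kerr.rPlus M a)) ∧
      (∃ y ∈ Kerr.slice a (Kerr.rPlus M a), Φ y ≠ 0) ∧
      (∃ C κ : ℝ, 0 < κ ∧ ∀ y ∈ Kerr.slice a (Kerr.rPlus M a),
        ‖Φ y‖ ≤ C * Real.exp (-(κ * ‖y‖)) ∧ ‖fderiv ℝ Φ y‖ ≤ C * Real.exp (-(κ * ‖y‖))) ∧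
      ∀ y ∈ Kerr.slice a (Kerr.rPlus M a), reducedWaveOp M a w Φ y = μ ^ 2 * Φ y

/-- **Profile equation ⟹ spacetime equation**: a profile which is `C^∞` on the exterior slice and
solves `P_ω Φ = μ²Φ` there gives the real mode `Re(e^{−iωt_KS}Φ)` solving `□_g ψ = μ²ψ` on the
exterior chart (`dalembertian_modeRe` and `Re(e^{−iωx⁰} μ² Φ) = μ² Re(e^{−iωx⁰} Φ)`, `μ` real).
SR, CMP 329 (2014), §1.3 and §2. [cite: ShlapentokhRothman2014KleinGordon, §1.3 and §2] -/
theorem dalembertian_modeRe_of_reducedWaveOp [Kerr.Facts] [Kerr.SliceFacts] {M a μ : ℝ} (w : ℂ)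
    {Φ : E3 → ℂ} (hΦ : ContDiffOn ℝ ∞ Φ (Kerr.slice a (Kerr.rPlus M a)))
    (hsol : ∀ y ∈ Kerr.slice a (Kerr.rPlus M a), reducedWaveOp M a w Φ y = μ ^ 2 * Φ y)
    (x : Kerr.exterior M a) :
    (Kerr.smoothMetric M a (Kerr.rPlus M a)).toPseudoRiemannianMetric.dalembertian
        (fun x : Kerr.exterior M a ↦ modeRe w Φ x) x = μ ^ 2 * modeRe w Φ x := by
  have hy : E4.spatial x.1 ∈ Kerr.slice a (Kerr.rPlus M a) := by
    rw [← Kerr.ofTimeSpace_mem_exterior_iff (t := E4.time x.1), E4.ofTimeSpace_time_spatial]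
    exact x.2
  refine (dalembertian_modeRe w hΦ x).trans ?_
  rw [modeC, hsol _ hy, show Complex.exp (-(Complex.I * w) * ((x.1 0 : ℝ) : ℂ)) *
      (μ ^ 2 * Φ (E4.spatial x.1)) = ((μ ^ 2 : ℝ) : ℂ) *
      (Complex.exp (-(Complex.I * w) * ((x.1 0 : ℝ) : ℂ)) * Φ (E4.spatial x.1)) by push_cast; ring,
    Complex.re_ofReal_mul]
  rfl

/-- **Profile form ⟹ the barrier fact** (Theorem 1.2 ⟹ Theorem 1.1, vendored energy form): the
data `(μ, ω, Φ)` of `ShlapentokhRothman2014_unstableModeProfile` give the real mode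
`ψ = Re(e^{−iωt_KS}Φ)`, which solves `□_g ψ = μ²ψ` on the exterior chart
(`dalembertian_modeRe_of_reducedWaveOp`) and has the smoothness, the finite Klein–Gordon energy on
every leaf and the lower bound `sliceEnergy ψ τ ≥ c₀ e^{2 Im ω τ}` of
`exists_sliceEnergy_growth_of_mode`; take `ε = 2 Im ω > 0`, `c = c₀ > 0`. SR, CMP 329 (2014),
Thm. 1.1 from Thm. 1.2. [cite: ShlapentokhRothman2014KleinGordon, Thm. 1.1 and Thm. 1.2] -/
theorem KleinGordonSuperradiantInstability.of_unstableModeProfile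
    (h : ShlapentokhRothman2014_unstableModeProfile) : KleinGordonSuperradiantInstability := by
  intro _ _ M a hMa ha m hm δ hδ
  obtain ⟨μ, hμ, hμδ, w, hwim, hwre, -, Φ, hΦ, hne, ⟨C, κ, hκ, hdec⟩, hsol⟩ := h M a hMa ha m hm δ hδ
  obtain ⟨c₀, hc₀, hsmooth, hfin, hgrow⟩ :=
    exists_sliceEnergy_growth_of_mode (w := w) hμ.ne' hwre hΦ hne hκ hdec
  exact ⟨μ, hμ, hμδ, 2 * w.im, by positivity, c₀, hc₀, fun x ↦ modeRe w Φ x, hsmooth,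
    dalembertian_modeRe_of_reducedWaveOp w hΦ hsol, fun τ _ ↦ hfin τ, fun τ _ ↦ hgrow τ⟩

end Literature.Barriers.FinalStateConjecture

end
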